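import Summits.BirchSwinnertonDyer.BirchSwinnertonDyer.Theorems.ResidualThetaTransportAtTwoCmLambdaLowerOfCorank
import Summits.BirchSwinnertonDyer.BirchSwinnertonDyer.Theorems.ResidualThetaTransportAtTwoLambdaLowerBoundOAlgebra
import Summits.BirchSwinnertonDyer.BirchSwinnertonDyer.Theorems.ThetaPartnerAtTwoSignedKatoUpToAtTwoLocalTwoPlusColemanKernelSigned
import Summits.BirchSwinnertonDyer.BirchSwinnertonDyer.Theorems.ThetaPartnerAtTwoSignedKatoUpToAtTwoPointsColemanLinear
import Literature.NumberTheory.EllipticCurves.Sprung2012.SharpFlatSelmer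
import Literature.NumberTheory.EllipticCurves.Kato2004.ZetaQuotientPackageCoeff
import HarnessLib

/-!
# Sketch — stub-ideation k = 2, generation 2 («♭-Selmer witness road») for the registered stub
# `stub_cmLambdaLower` (S2) of `Cruxes/ResidualThetaCountLowerPureAtTwo/Lines/bt26_lambda.lean` (v6)

Scratch file of seat `planner-sidea-stub_cmLambdaLower-2-g2-0`. It TYPES the helper lemmas of the revised idea
card `Ideas/stub-cmlambdalower-k2.md` (gen 2) over existing declarations, and proves, sorry-free, the kernel
composition of the corank half of the top plan in the currency of the landed reduction
`LambdaLowerBoundO.cmLambdaLower_of_corank` (hypothesis `hcorank : m ≤ finrank 𝒪 (X ⧸ torsion)`):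
«♭-four-term exact sequence with λ-equal flanks and middle term of generic rank `m`  ⟹  `m ≤ rank_𝒪 (X♭ / tors)`».

§1 = the local dictionary at `p = 2` (LANDED: cite-list) + the one classes-level identification D1; §2 = the port signatures (research-level, honest `Prop`s, nothing asserted);
§3 = the proved composition. Named `def … : Prop` items are SIGNATURES (helper lemmas to prove; nothing is
asserted); theorems are proved. The stub is NOT proved; S2 / items 26074, 22608 stay OPEN;
BSD is NOT proved by any of this.
-/

set_option autoImplicit false
set_option linter.dupNamespace false

noncomputable section

open scoped Classical TensorProduct

namespace Summit.BirchSwinnertonDyer.BirchSwinnertonDyer.Cruxes.ResidualThetaCountLowerPureAtTwo.StubIdeasK2G2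

open Literature.NumberTheory.EllipticCurves Literature.NumberTheory.EllipticCurves.Kobayashi2003
  Literature.NumberTheory.EllipticCurves.Sprung2012 Literature.NumberTheory.EllipticCurves.Sprung2017
  Literature.NumberTheory.GaloisRepresentations
  Summit.BirchSwinnertonDyer.BirchSwinnertonDyer.Theorems

universe u

/-! ## §1 The local dictionary at `p = 2` is LANDED — cite, do not re-prove

Sprung 2012 §7 object (a_p = 0, p = 2) ↦ tree theorem (all in `Summit.…Theorems` unless marked):
* Honda points `d_{2k} ∈ E⁺(K_{2k}·E_w)` (kind `1`): `SignedEC.d_even_mem_signedLocalPointsOfEmb_one`,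
  `…localTraceOfEmb_d_even_mem`; two-step traces: `localTraceOfEmb_eq_localPairTraceOfEmb(_two)`.
* `a_p = 0` shape of `(u_n, v_n)` at even `n` + «divisible by all `ω⁺_{2k}` ⟹ 0»:
  `SignedKatoOffTwo.ColemanConverse.flat_eq_zero_of_isColemanPair_of_pairingSum_even_eq_zero`,
  `….eq_zero_of_forall_even_hasSum_zero`.
* `ann(E⁺_∞) ⊆ Ker Col♭` (NO generation clauses needed): `….mem_colemanKer_flat_of_forall_signedPlus_of_trace`
  (general `K`, `E`, `p`), `….exists_tower_ann_signedPlus_le_colemanKer_flat_two`; the converse (uses (GEN), (GEN₀)):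
  `SignedKatoOffTwo.LocalTwo.colemanKer_flat_annihilates_signedPlus_two_of_honda`; together
  `….mem_colemanKer_flat_iff_forall_signedPlus_two_of_honda` = Sprung's `E♭_∞ = (Ker Col♭)^⊥` IS Kobayashi's
  saturated `E⁺_∞ ⊗ ℚ₂/ℤ₂` at `a₂ = 0` — i.e. Sprung's Open Problem 7.22 is SOLVED in the tree for `a₂ = 0, p = 2`.
* `Col♭` exists, is `Λ`-linear, ONTO `Λ` at `2`: `SignedKatoOffTwo.ColemanLinear.exists_colemanLinearMap_two`,
  `SignedLowerOffTwo.ColemanOnto.exists_plusHonda_flat_onto_two`; HONDA⁺@2: `SignedEC.stub_plusHondaSystemTwo` (p591589).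
So at the level of FUNCTIONALS the identification «S2's local clause at `v ∣ 2` = Sprung Def. 7.9's ♭-condition» is a
tree theorem. The one piece NOT in the tree is the same identification at the level of KUMMER CLASSES, i.e. between the
TYPED Literature object `Sprung2012.sharpFlatLocalKummerOverOfEmb … (colemanKer … .flat)` and S2's
`localKummerOverOfEmb … (⨆ m, E⁺_m)`-shaped clause — needed only if the port consumes Sprung's typed §7
(`sharpFlatSelmerInfty`, `SharpFlatSelmerDualData`, the `p ≠ 2` fact `thm714seq_sharpFlatColemanKato_zeta`) rather
than TP2's own Selmer-structure bricks. -/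

/-- **D1 `FlatKummerEqPlusKummerTwo`** — Sprung's Def. 7.9 local condition (Kummer classes of `x ⊗ 2^{-k}`,
`x ∈ E(K_∞·E_w)`, orthogonal to `Ker Col♭`) EQUALS the Kummer condition with respect to the saturated plus points
`⨆ₘ E⁺(K_m·E_w)`, for a plus Honda system at `2` with the generation clauses. `≤`: from the landed
`mem_colemanKer_flat_of_forall_signedPlus_of_trace` (`ann(E⁺) ⊆ Ker Col♭` ⟹ `(Ker Col♭)^⊥ ⊆ ann(E⁺)^⊥ = E⁺_sat ⊗ ℚ₂/ℤ₂`)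
plus layer bookkeeping (functionals on `E(K_n·E_w)` extend to the tower since `E(K_n) ≤ E(K_{n'})` is saturated — no
`2`-torsion, hypothesis `hnt` / `Sprung2012.lem23_localTowerPoints_noPTorsion` — and `E(K_n) ∩ E⁺_{n'} = E⁺_n`; the
representing point moves by a tower point and a `2`-power torsion point = a coboundary); `≥`: from the landed
`colemanKer_flat_annihilates_signedPlus_two_of_honda`. Why it might fail: only in the saturation bookkeeping (finite free
`ℤ₂`-modules level by level). Size M/L. [cite: Sprung2012, Def. 7.9, Lemma 7.4–7.5, Open Problem 7.22 (pp. 1500–1505)] -/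
def FlatKummerEqPlusKummerTwo : Prop :=
  ∀ (W : WeierstrassCurve ℚ) {κ : ZpExtension ℚ 2}, κ.IsCyclotomic →
    ∀ (ι : AlgebraicClosure ℚ →ₐ[ℚ] AlgebraicClosure ℚ_[2]) (H : Subgroup (Field.absoluteGaloisGroup ℚ)),
    (∀ P ∈ localTowerPointsOfEmb κ ι W, 2 • P = 0 → P = 0) →
    ∀ (g : Field.absoluteGaloisGroup ℚ_[2]), κ.IsTopGenerator (resGalOfEmb ι g) →
    ∀ (d : ℕ → localPoints W ℚ_[2]), (∀ n, d n ∈ localLayerPointsOfEmb κ ι W n) →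
    (∀ m, localTraceOfEmb κ ι W (m + 1) (m + 2) (d (m + 2)) = -d m) →
    (∀ m : ℕ, 1 ≤ m → ∀ P ∈ localLayerPointsOfEmb κ ι W m,
      ∃ B ∈ AddSubgroup.closure (Set.range fun σ : Field.absoluteGaloisGroup ℚ_[2] ↦ σ • d m),
        ∃ P' ∈ localLayerPointsOfEmb κ ι W (m - 1), ∃ R ∈ localLayerPointsOfEmb κ ι W m, P = B + P' + 2 • R) →
    (∀ P ∈ localLayerPointsOfEmb κ ι W 0, ∃ a : ℤ, ∃ R ∈ localLayerPointsOfEmb κ ι W 0, P = a • d 0 + 2 • R) →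
    sharpFlatLocalKummerOverOfEmb W 2 H ι (localTowerPointsOfEmb κ ι W) (colemanKer κ ι W 0 g d .flat) =
      localKummerOverOfEmb W 2 H ι (⨆ m, signedLocalPointsOfEmb κ ι W 1 m)

/-! ## §2 Port signatures for the corank EQUALITY `λ(X♭_{S₀}) = d + Σ_g(S₀)` (research-level; honest `Prop`s)

Typed here over tree objects: the universal-norm input for the `𝐇¹`-currency glue `col₀` and the flank-equality bridge; the global four-term sequence for
`ρ_{g,λ} ⊗ Λ` (the `𝒪`-coefficient, `p = 2` twin of `Sprung2012.thm714seq_sharpFlatColemanKato_zeta`) and the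
explicit reciprocity law are recorded in the card with page-level sources (Sprung 2012 §§5–6 cover `p = 2` in
print; Kato §12 all `p`). -/

/-- **H-UN `UnivNormsTorsionTwo`** — universal norms in the supersingular local tower at `2` are torsion: a
level-`m` point that is a trace from every higher level is killed by some positive integer (Hazewinkel 1974
for unramified base, no parity hypothesis; Sprung 2012 Lemma 7.10 cites [CG], [Ha]; ⊗ℚ this is what makes the
`Λ`-adic Tate-pairing map `col₀ : H¹_Iw(K_{∞,w}, T) → Hom(E(K_∞·E_w), ℤ₂)` an isomorphism up to `λ = 0`).
Why it might fail: it does not for height-2 formal groups; the typed form must exclude prime-to-`2` torsion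
(hence «`∃ k > 0, k • P = 0`», not «`P = 0`»). [cite: Sprung2012, Lemma 7.10 (p. 1503)] -/
def UnivNormsTorsionTwo : Prop :=
  ∀ (W : WeierstrassCurve ℚ) [W.IsElliptic] [W.IsGloballyMinimal],
    W.HasGoodReductionAtPrime 2 → W.frobeniusTrace 2 = 0 →
    ∀ (κ : ZpExtension ℚ 2), κ.IsCyclotomic →
    ∀ (ι : AlgebraicClosure ℚ →ₐ[ℚ] AlgebraicClosure ℚ_[2]) (m : ℕ),
    ∀ P ∈ localLayerPointsOfEmb κ ι W m,
      (∀ n, m ≤ n → ∃ Q ∈ localLayerPointsOfEmb κ ι W n, localTraceOfEmb κ ι W m n Q = P) →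
      ∃ k : ℕ, 0 < k ∧ k • P = 0

/-- **H-λchar `FinrankEqOfCharIdealEqUpToConst`** — the FLANK-EQUALITY BRIDGE: a characteristic-ideal identity
up to non-zero constants of `A` between two finitely generated torsion `A⟦X⟧`-modules (the currency of
`Kato2004.ZetaQuotientPackage.CharIdealEqUpToConst`, = Burungale–Tian Thm. 2.6 typed) gives equality of generic
`A`-ranks `dim_K K ⊗_A M = dim_K K ⊗_A N` (`K = Frac A`): both sides are additive in exact sequences
(`LambdaLowerBoundO.finrank_baseChange_add_eq_of_exact`), vanish on `ϖ`-power-torsion and pseudo-null modules, and equal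
the Weierstrass degree on `A⟦X⟧/(f)` (`finrank_quotientTorsion_quotient_span_eq_of_normLambda`). An ALTERNATIVE to the
critic's A1 `LengthEqOffConstants` + A3 `FinrankMonoOfLengthLe` (no height-one localisation, no UFD input). Why it might
fail: needs the tree's `Module.charIdeal` to be computable on a filtration with cyclic quotients (its API:
`exists_charIdeal_eq_span_prod`-type lemmas); if that API is length-based, A1+A3 is the shorter road. Size M/L. -/
def FinrankEqOfCharIdealEqUpToConst : Prop :=
  ∀ {A : Type} [CommRing A] [IsDomain A] [IsDiscreteValuationRing A] (K : Type) [Field K] [Algebra A K]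
    [IsFractionRing A K] (M N : Type) [AddCommGroup M] [Module (PowerSeries A) M] [Module A M]
    [IsScalarTower A (PowerSeries A) M] [AddCommGroup N] [Module (PowerSeries A) N] [Module A N]
    [IsScalarTower A (PowerSeries A) N],
    Module.Finite (PowerSeries A) M → Module.IsTorsion (PowerSeries A) M →
    Module.Finite (PowerSeries A) N → Module.IsTorsion (PowerSeries A) N →
    ∀ c d : A, c ≠ 0 → d ≠ 0 →
      Ideal.span {PowerSeries.C c} * Module.charIdeal (PowerSeries A) M =
        Ideal.span {PowerSeries.C d} * Module.charIdeal (PowerSeries A) N →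
      Module.finrank K (K ⊗[A] M) = Module.finrank K (K ⊗[A] N)

/-! ## §3 The corank reading, proved (currency of `cmLambdaLower_of_corank`'s `hcorank`) -/

section Corank

universe v w

variable {𝒪 : Type v} [CommRing 𝒪] [IsDomain 𝒪] [IsPrincipalIdealRing 𝒪]
  (K : Type w) [Field K] [Algebra 𝒪 K] [IsFractionRing 𝒪 K]
variable {A B X D : Type w} [AddCommGroup A] [Module 𝒪 A] [AddCommGroup B] [Module 𝒪 B]
  [AddCommGroup X] [Module 𝒪 X] [AddCommGroup D] [Module 𝒪 D]

/-- **♭-WITNESS CORANK READING.** For an `𝒪`-linear four-term exact sequence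
`0 → A → B → X → D → 0` (meant: `A = 𝐇¹(T_ρ)/Z`, `B = I/Col♭col₀(loc Z)` with `I = Im(Col♭ ∘ col₀) ⊆ Λ_𝒪`,
`X = X♭_{S₀}(ρ/ℚ_∞)`, `D = X₀`), with λ-EQUAL FLANKS (`dim_K K⊗A = dim_K K⊗D`: both `= λ(𝐇²)` by
Burungale–Tian Thm. 2.6 (even component) and Kurihara-at-`2`), and middle term of generic rank `≥ m`
(`m = d + Σ_g(S₀)` by the explicit reciprocity law + `λ(Λ/I) = 0`), the dual `X` has
`m ≤ rank_𝒪 (X / X_tors)` — exactly hypothesis `hcorank` of `LambdaLowerBoundO.cmLambdaLower_of_corank`.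
Kernel: `finrank_baseChange_eq_of_exact_of_eq` (p625690) + `finrank_baseChange_eq_finrank_quotientTorsion`. -/
theorem le_finrank_quotientTorsion_of_flatFourTerm (f : A →ₗ[𝒪] B) (g : B →ₗ[𝒪] X) (h : X →ₗ[𝒪] D)
    (hf : Function.Injective f) (hfg : Function.Exact f g) (hgh : Function.Exact g h)
    (hh : Function.Surjective h)
    [FiniteDimensional K (K ⊗[𝒪] B)] [FiniteDimensional K (K ⊗[𝒪] X)] [Module.Finite 𝒪 X]
    (hAD : Module.finrank K (K ⊗[𝒪] A) = Module.finrank K (K ⊗[𝒪] D))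
    {m : ℕ} (hB : m ≤ Module.finrank K (K ⊗[𝒪] B)) :
    m ≤ Module.finrank 𝒪 (X ⧸ Submodule.torsion 𝒪 X) := by
  rw [← LambdaLowerBoundO.finrank_baseChange_eq_finrank_quotientTorsion K X,
    ← LambdaLowerBoundO.finrank_baseChange_eq_of_exact_of_eq K f g h hf hfg hgh hh hAD]
  exact hB

/-- The same reading with the middle term PINNED: if moreover `dim_K K⊗B = m` then `rank_𝒪(X/X_tors) = m`
(the ♭-road computes `λ(X♭_{S₀})` EXACTLY, which the trace-plus road cannot do without `Ker Col♭ = ann(E⁺)`). -/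
theorem finrank_quotientTorsion_eq_of_flatFourTerm (f : A →ₗ[𝒪] B) (g : B →ₗ[𝒪] X) (h : X →ₗ[𝒪] D)
    (hf : Function.Injective f) (hfg : Function.Exact f g) (hgh : Function.Exact g h)
    (hh : Function.Surjective h)
    [FiniteDimensional K (K ⊗[𝒪] B)] [FiniteDimensional K (K ⊗[𝒪] X)] [Module.Finite 𝒪 X]
    (hAD : Module.finrank K (K ⊗[𝒪] A) = Module.finrank K (K ⊗[𝒪] D))
    {m : ℕ} (hB : Module.finrank K (K ⊗[𝒪] B) = m) :
    Module.finrank 𝒪 (X ⧸ Submodule.torsion 𝒪 X) = m := by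
  rw [← LambdaLowerBoundO.finrank_baseChange_eq_finrank_quotientTorsion K X,
    ← LambdaLowerBoundO.finrank_baseChange_eq_of_exact_of_eq K f g h hf hfg hgh hh hAD]
  exact hB

end Corank

end Summit.BirchSwinnertonDyer.BirchSwinnertonDyer.Cruxes.ResidualThetaCountLowerPureAtTwo.StubIdeasK2G2

end
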